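import Summits.QuantumFields.YangMills.Theorems.BalabanUVNodesN16OfSocketsZd3
import HarnessLib

/-!
# Route «BalabanUVNodes» (K3⁗ `SpineGivenEndpointR13Sep`), DAG node N16 = NE3 — THE R-β″ (MULTI-SCALE HÖLDER) AND HFP₄ TOPS OF THE N05 → N16 EDGE KEYED AT THE
# PINNED ALL-TORUS MEMBERS (`η = L^{−k}`, inside node N05's record sub-index `IdxB8SubB`) — companion of `BalabanUVNodesN16OfSocketsAllTorusPinned` (β = 1 root)

Cell `pub-ymgap`, seat `pub-ymgap-dag-n16-c` (R134 fan-out seat, strategy s1; HUMAN RULING D-0062; chair R424 venue), generation 6, file 48 — over generation 4's files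
33 ∕ 34 ∕ 36 (`N16HolderMSPrintOfLeaf.thm4TorusAt_zero_printMS_of_leaf_member`, `N16HolderMSOfLeaf.thm4TorusAt_printMS_of_leaf`, `N16HolderMSOfLeafTop.n16_holderMS_of_leaf`),
generation 5's file 42 and this generation's files 46 ∕ 47.  `--supports stmt-QuantumFields-20292 --as helper` (K3⁗).  `bears_on: R4∕N16 · edge N05 → N16`.

WHY.  File 46 re-keyed the multi-scale Hölder tops at the all-torus proper members for EVERY spacing `η > 0`; file 47 pinned the β = 1 root to `η = L^{−k}` (the
members N16 reads, all inside `IdxB8SubB` — file 47 §1 `idxB8LawsB_allTorusPinned`).  THIS file pins the R-β″ chain (any `β ∈ [0, 1]`, node N05's residual exponent)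
and the `HFP₄` variant the same way: sub-index `{i : ZdIdx 4 L // (∀ j, i.Ω j = univ) ∧ (∀ m j, i.Λs m j = {j = m}) ∧ (∀ m j, i.Λb m j = {j = m}) ∧ i.η = (L⁻¹)^{i.k}}`
(spelled inline).

WHAT THIS FILE PROVES (kernel, theorems only, 0 `def`, 0 sorry):
* §1 `thm4TorusAt_printMS_of_leaf_allTorusPinned` — file 34's multi-scale (T4^ℤᵈ_print-MS) at every `k ≥ 1`, `η = L^{−k}`, from the leaf clauses on the pinned sub-family
  (file 33's `…_member` at the member of `exists_member_univ` at `η = (Lᵏ)⁻¹`).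
* §2 `n16_holderMS_of_leafAllTorusPinned` — file 36's `n16_holderMS_of_leaf` (`… → CovRootHolderMS 4 (sfClass 4 L N ε) L N b g C s₁ s₂ β dom`, VERBATIM) on the pinned
  sub-family.
* §3 ★ `n16_holderMS_of_socketsAllTorusPinned_l1Len` and `n16_holderMS_of_socketsHFP₄AllTorusPinned_l1Len` — file 42's two R-β″ tops with n05-a's sockets demanded AT
  THE PINNED ALL-TORUS MEMBERS ONLY (print's ℓ¹ length; both length letters discharged); conclusions VERBATIM.

HONEST FRAMING: a re-key by name; nothing of Bałaban is proved here; the sockets at the pinned members are node N05's ∕ N06's open obligations, (H3ˢᵘᵖ) = N07's;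
N16 ∕ NE3 NOT discharged; count-neutral; one finite four-torus at fixed ε — NOT ℝ⁴, NOT infinite volume, NOT OS, NOT a mass gap, NOT Clay.
-/

set_option autoImplicit false

open scoped BigOperators Matrix Matrix.Norms.L2Operator
open NormedSpace

namespace Summit.QuantumFields.YangMills.BalabanUVNodes.N16HolderMSOfSocketsAllTorusPinned

open Literature.MathematicalPhysics.QuantumFieldTheory.Balaban1983to89
open B7Prop1Explicit B7Prop2Explicit
open B7Prop3Flat (c3)
open B7Eq78Linearization (conjR)
open B7Eq92Concrete (mgauge)
open B8Ineq132 (InAk covDerivFwd)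
open B8Eq184Proof (cfgExp)
open B8Eq119TwistedAxial (Restr129)
open B8Eq133Hypotheses (Reg335Zd)
open B8Eq138LandauZd (IsLandau138 covLap)
open B9Eq340HolderZd (AdmPair mem_admPair l1Len one_le_l1Len)
open B8Thm4TorusAt (torusLam Thm4TorusAt)
open B8LeafModelZd (ZdIdx SockP5base SockP5 SockH59)
open B8LeafModelZd3 (zdGF3 SockB9P3)
open B8LeafModelZdSockP5uE (SockP5uE)
open B8LeafModelZdOfHFP (SockHFP₀ SockHFP)
open B8LeafModelZd3NonVacuity (exists_member_univ)
open Summit.QuantumFields.BalabanUV.T4Continuum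
open T4AveragingDeficitWall (Ad)
open MinimalActionClassSix (conjR_eq_Ad)
open BlockAverageCurrent (curConst)
open NE3RightInverseSupLetters (frameC)
open NE3.LeafIndexSockets (LeafH3sup)
open MinimalActionRate (sfClass)
open Summit.QuantumFields.YangMills.BalabanUVNodes.N16HolderMSDefs (CovRootHolderMS)
open Summit.QuantumFields.YangMills.BalabanUVNodes.N16HolderMSPrintOfLeaf (thm4TorusAt_zero_printMS_of_leaf_member)
open Summit.QuantumFields.YangMills.BalabanUVNodes.N16HolderMSOfThm4Output (n16_holderMS_of_thm4TorusAt_printMS)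
open Summit.QuantumFields.YangMills.BalabanUVNodes.N16HolderMSTorusOfZd (thm4TorusAt_printMS_of_zd)
open Summit.QuantumFields.YangMills.BalabanUVNodes.N16HolderMSOfLeafTop (n16_holderMS_of_thm4Zd_printMS)
open Summit.QuantumFields.YangMills.BalabanUVNodes.N16HolderMSOfLeafL1 (l1Len_nsmul_e)
open Summit.QuantumFields.YangMills.BalabanUVNodes.N16.OfLeaf (exists_window_print thm4TorusAt_concl_congr)

noncomputable section

variable {d : ℕ}

section Matrices

variable {n : Type} [Fintype n] [DecidableEq n]

/-! ## §1 The leaf clauses on the PINNED all-torus sub-family ⟹ the multi-scale (T4^ℤᵈ_print-MS) at `η = L^{−k}` (file 34 re-keyed) -/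

/-- **THE LEAF CLAUSES ON THE PINNED ALL-TORUS SUB-FAMILY ⟹ THE MULTI-SCALE (T4^ℤᵈ_print-MS) AT `η = L^{−k}`, VERBATIM** (`𝔸 = M_n(ℂ)`; `d, L ≥ 2`; `β ≥ 0`, `len ≥ 1`
on its support with `len (j•e_μ) = j`): file 34's `thm4TorusAt_printMS_of_leaf` with the family over `{i // (∀ j, i.Ω j = univ) ∧ (∀ m j, i.Λs m j = {j = m}) ∧ (∀ m j,
i.Λb m j = {j = m}) ∧ i.η = (L⁻¹)^{i.k}}` (file 33's `…_member` at the pinned member of `exists_member_univ` at `η = (Lᵏ)⁻¹`).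
[cite: Balaban1985RegularSpaces, Thm 4 p.88, Prop. 3 p.87, (1.36)–(1.39) pp.82–83, p.77 («Ω_j = T_η»); Balaban1985BackgroundPropagators, (3.40) p.397] -/
theorem thm4TorusAt_printMS_of_leaf_allTorusPinned [Nonempty n] (hd2 : 2 ≤ d) {L : ℕ} (hL : 2 ≤ L) {β : ℝ} (hβ : 0 ≤ β) {len : Site d → ℝ}
    (hlen : ∀ v : Site d, 0 < len v → 1 ≤ len v) (hlenj : ∀ (μ : Fin d) (j : ℕ), len (j • e μ) = j) {c₁ c₁' B₁' cP C₂ B₀β : ℝ} {inp : B8.B9Inputs}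
    (hB₁' : 0 < B₁') (hBB : 5 * (d : ℝ) * L * inp.B₀ ≤ B₁')
    (hwin : ∀ α₀ α₁ : ℝ, 0 < α₀ → 0 < α₁ → α₀ + α₁ ≤ c₁' →
      α₀ + α₁ ≤ c₁ ∧ C0 d * (2 * α₀) ≤ 1 / 3 ∧ 4 * α₀ ≤ c2' d L ∧ 16 * (B₁' * (α₀ + α₁)) ≤ 1 ∧
      Real.exp (4 * (800 * ((d : ℝ) + 1) ^ 2 * ((d : ℝ) + 4)) * α₀) * (1 + 8 * (131072 * ((d : ℝ) + 1) ^ 2) * (B₁' * (α₀ + α₁))) ≤ 2 ∧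
      2 * (B₁' * (α₀ + α₁)) ≤ c3 d L ∧ (d : ℝ) * L * α₁ ≤ 1 / 8 ∧ α₀ ≤ cP ∧ α₁ ≤ cP ∧ B₁' * (α₀ + α₁) ≤ cP ∧
      2 * (B₁' * (α₀ + α₁)) ^ 2 + 20 * d * α₀ * (B₁' * (α₀ + α₁)) + 2 * C₂ * (B₁' * (α₀ + α₁)) ^ 2 ≤ α₀ + α₁)
    (Reg : ℕ → (Site d → Fin d → (Matrix n n ℂ)ˣ) → Prop) :
    letI : CStarAlgebra (Matrix n n ℂ) := {}
    B8.Thm4Body c₁ B₁' (fun i : {i : ZdIdx d L // (∀ j, i.Ω j = Set.univ) ∧ (∀ m j, i.Λs m j = {_y | j = m}) ∧ (∀ m j, i.Λb m j = {_c | j = m}) ∧ i.η = ((L : ℝ)⁻¹) ^ i.k} =>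
      (zdGF3 (Matrix n n ℂ) L β len i.1).toGFData) →
    B8.Prop3Body cP d (L : ℝ) C₂ inp B₀β (fun i : {i : ZdIdx d L // (∀ j, i.Ω j = Set.univ) ∧ (∀ m j, i.Λs m j = {_y | j = m}) ∧ (∀ m j, i.Λb m j = {_c | j = m}) ∧ i.η = ((L : ℝ)⁻¹) ^ i.k} =>
      (zdGF3 (Matrix n n ℂ) L β len i.1).toGFData2) →
    ∀ k, 1 ≤ k → Thm4TorusAt L k 0 (((L : ℝ) ^ k)⁻¹) c₁' (unitaryUnits (Matrix n n ℂ)) (Reg k) (Restr129 L k (torusLam k))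
      (fun (α₀ α₁ : ℝ) (U₀ U' : Site d → Fin d → (Matrix n n ℂ)ˣ) (u : Site d → (Matrix n n ℂ)ˣ) =>
        ∃ A : Site d → Fin d → Matrix n n ℂ,
          (∀ x μ, IsSelfAdjoint (A x μ)) ∧ mgauge U₀ u (cfgExp (((L : ℝ) ^ k)⁻¹) A) = U' ∧
          (∀ x μ, ‖A x μ‖ ≤ 5 * (d : ℝ) * L * inp.B₀ * (α₀ + α₁)) ∧
          (∀ (μ : Fin d) (x : Site d) (κ : Fin d),
            ‖covDerivFwd (((L : ℝ) ^ k)⁻¹) U₀ μ (fun z => A z κ) x‖ ≤ 5 * (d : ℝ) * L * inp.B₀ * (α₀ + α₁)) ∧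
          IsLandau138 L k (((L : ℝ) ^ k)⁻¹) Set.univ (torusLam k) U₀ A ∧
          (∀ (κ μ : Fin d) (y : Site d) (j : ℕ), 1 ≤ j → j ≤ L ^ k →
            ‖Ad (hol U₀ y (seg μ (j : ℤ))) (covDerivFwd (((L : ℝ) ^ k)⁻¹) U₀ μ (fun z => A z κ) (y + j • e μ))
                - covDerivFwd (((L : ℝ) ^ k)⁻¹) U₀ μ (fun z => A z κ) y‖
              ≤ 5 * (d : ℝ) * L * B₀β * (α₀ + α₁) * ((((L : ℝ)⁻¹) ^ k) ^ β * (j : ℝ) ^ β)) ∧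
          (∀ (x : Site d) (κ : Fin d), ‖covLap (((L : ℝ) ^ k)⁻¹) U₀ (fun z => A z κ) x‖ ≤ 5 * (d : ℝ) * L * inp.B₀ * (α₀ + α₁))) := by
  letI : CStarAlgebra (Matrix n n ℂ) := {}
  intro hT hP k hk
  have hL1 : 1 ≤ L := le_trans (by norm_num) hL
  have hL1r : (1 : ℝ) ≤ L := by exact_mod_cast hL1
  have hLk : (1 : ℝ) ≤ (L : ℝ) ^ k := one_le_pow₀ hL1r
  have hη : 0 < ((L : ℝ) ^ k)⁻¹ := by positivity
  have hη1 : ((L : ℝ) ^ k)⁻¹ ≤ 1 := inv_le_one_of_one_le₀ hLk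
  obtain ⟨i, -, hik, hiη, hΩ, hΛs, hΛb⟩ := exists_member_univ (d := d) hL1 hk hη
  have hpin : i.η = ((L : ℝ)⁻¹) ^ i.k := by rw [hiη, hik, inv_pow]
  have h := thm4TorusAt_zero_printMS_of_leaf_member hd2 hL hβ hlen i hΩ hΛs hB₁' hBB hwin (Reg k) (hT ⟨i, hΩ, hΛs, hΛb, hpin⟩)
    (hP ⟨i, hΩ, hΛs, hΛb, hpin⟩)
  rw [hik, hiη] at h
  refine thm4TorusAt_concl_congr (fun α₀ α₁ U₀ U' u => ?_) h
  -- the letter identities at `η = L^{-k}`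
  have hLk0 : (0 : ℝ) < (L : ℝ) ^ k := by positivity
  have hw : (L : ℝ) ^ k * ((L : ℝ) ^ k)⁻¹ = 1 := mul_inv_cancel₀ hLk0.ne'
  have hw2 : ((L : ℝ) ^ k * ((L : ℝ) ^ k)⁻¹) ^ (-(2 : ℝ)) = 1 := by rw [hw, Real.one_rpow]
  have hw3 : ((L : ℝ) ^ k * ((L : ℝ) ^ k)⁻¹) ^ (-(3 : ℝ)) = 1 := by rw [hw, Real.one_rpow]
  have hwβ : ((L : ℝ) ^ k * ((L : ℝ) ^ k)⁻¹) ^ (-(2 + β)) = 1 := by rw [hw, Real.one_rpow]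
  have hηβ : ∀ (μ : Fin d) (j : ℕ), (((L : ℝ) ^ k)⁻¹ * len (j • e μ)) ^ β = (((L : ℝ)⁻¹) ^ k) ^ β * (j : ℝ) ^ β := fun μ j => by
    rw [hlenj μ j, inv_pow, Real.mul_rpow (by positivity) (Nat.cast_nonneg j)]
  -- admissibility of the line pair `(y, y + j•e_μ)` iff `1 ≤ j ≤ L^k`
  have hadm : ∀ (μ : Fin d) (y : Site d) (j : ℕ), 1 ≤ j → j ≤ L ^ k → (y, y + j • e μ) ∈ AdmPair (((L : ℝ) ^ k)⁻¹) len := by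
    intro μ y j hj hjL
    rw [mem_admPair]
    simp only [add_sub_cancel_left, hlenj μ j]
    refine ⟨by exact_mod_cast hj, ?_⟩
    have hjr : (j : ℝ) ≤ (L : ℝ) ^ k := by exact_mod_cast hjL
    rw [← div_eq_inv_mul, div_le_one hLk0]
    exact hjr
  have hadm' : ∀ (μ : Fin d) (y : Site d) (j : ℕ), (y, y + j • e μ) ∈ AdmPair (((L : ℝ) ^ k)⁻¹) len → 1 ≤ j ∧ j ≤ L ^ k := by
    intro μ y j hp
    rw [mem_admPair] at hp
    simp only [add_sub_cancel_left, hlenj μ j] at hp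
    obtain ⟨hp1, hp2⟩ := hp
    refine ⟨by exact_mod_cast hp1, ?_⟩
    rw [← div_eq_inv_mul, div_le_one hLk0] at hp2
    exact_mod_cast hp2
  constructor
  · rintro ⟨A, h1, h2, h3, h4, h5, h6, h7⟩
    refine ⟨A, h1, h2, fun x μ => ?_, fun μ x κ => ?_, h5, fun κ μ y j hj hjL => ?_, fun x κ => ?_⟩
    · have h := h3 x μ; rwa [hw, inv_one, mul_one] at h
    · have h := h4 μ x κ; rwa [hw2, mul_one] at h
    · have h := h6 κ μ y j (hadm μ y j hj hjL); rwa [hwβ, mul_one, hηβ μ j] at h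
    · have h := h7 x κ; rwa [hw3, mul_one] at h
  · rintro ⟨A, h1, h2, h3, h4, h5, h6, h7⟩
    refine ⟨A, h1, h2, fun x μ => ?_, fun μ x κ => ?_, h5, fun κ μ y j hp => ?_, fun x κ => ?_⟩
    · rw [hw, inv_one, mul_one]; exact h3 x μ
    · rw [hw2, mul_one]; exact h4 μ x κ
    · obtain ⟨hj, hjL⟩ := hadm' μ y j hp
      rw [hwβ, mul_one, hηβ μ j]; exact h6 κ μ y j hj hjL
    · rw [hw3, mul_one]; exact h7 x κ

/-! ## §2 N16's multi-scale β-root from the leaf clauses on the pinned sub-family and N07's (H3ˢᵘᵖ) -/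

/-- **N16 · THE MULTI-SCALE β-ROOT FROM THE [B8] LEAF ON THE PINNED ALL-TORUS SUB-FAMILY OF `zdGF3 (M_n(ℂ)) L β len` AND N07's (H3ˢᵘᵖ)** (`d = 4`, `L ≥ 2`,
`N ≥ 1`, ANY `β ∈ [0, 1]`): generation 4's `n16_holderMS_of_leaf` with the two leaf clauses read over the PINNED all-torus sub-index; every other letter and the conclusion
VERBATIM, ending in `LeafH3sup 4 L N ε b′ c′ dom → CovRootHolderMS 4 (sfClass 4 L N ε) L N b g C s₁ s₂ β dom`.  N16 ∕ NE3 NOT proved.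
[cite: Balaban1985RegularSpaces, Thm 4 p.88, Prop. 3 p.87, (1.36) p.82] [folklore] -/
theorem n16_holderMS_of_leafAllTorusPinned [Nonempty n] {L N : ℕ} (hL : 2 ≤ L) (hN : 1 ≤ N) :
    letI : CStarAlgebra (Matrix n n ℂ) := {}
    ∃ r : ℝ, 0 < r ∧ ∀ ⦃g : ℝ⦄, 0 < g → ∃ C : ℝ, 0 ≤ C ∧
      ∀ (c₁ c₁' B₁' cP C₂ B₀β : ℝ) (inp : B8.B9Inputs) (len : Site 4 → ℝ), (∀ v : Site 4, 0 < len v → 1 ≤ len v) →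
      (∀ (μ : Fin 4) (j : ℕ), len (j • e μ) = j) → 0 < B₁' → 5 * ((4 : ℕ) : ℝ) * L * inp.B₀ ≤ B₁' → 16 * (5 * ((4 : ℕ) : ℝ) * L * inp.B₀ * c₁') ≤ 1 →
      (∀ α₀ α₁ : ℝ, 0 < α₀ → 0 < α₁ → α₀ + α₁ ≤ c₁' →
        α₀ + α₁ ≤ c₁ ∧ C0 4 * (2 * α₀) ≤ 1 / 3 ∧ 4 * α₀ ≤ c2' 4 L ∧ 16 * (B₁' * (α₀ + α₁)) ≤ 1 ∧
        Real.exp (4 * (800 * (((4 : ℕ) : ℝ) + 1) ^ 2 * (((4 : ℕ) : ℝ) + 4)) * α₀) *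
            (1 + 8 * (131072 * (((4 : ℕ) : ℝ) + 1) ^ 2) * (B₁' * (α₀ + α₁))) ≤ 2 ∧
        2 * (B₁' * (α₀ + α₁)) ≤ c3 4 L ∧ ((4 : ℕ) : ℝ) * L * α₁ ≤ 1 / 8 ∧ α₀ ≤ cP ∧ α₁ ≤ cP ∧ B₁' * (α₀ + α₁) ≤ cP ∧
        2 * (B₁' * (α₀ + α₁)) ^ 2 + 20 * ((4 : ℕ) : ℝ) * α₀ * (B₁' * (α₀ + α₁)) + 2 * C₂ * (B₁' * (α₀ + α₁)) ^ 2 ≤ α₀ + α₁) →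
      ∀ ⦃b' c' : ℝ⦄, 0 ≤ b' → 0 ≤ c' →
      2 ^ 15 * ((4 : ℝ) + 1) ^ 2 * ((4 : ℝ) + 4) ^ 2 * (L : ℝ) ^ 2 * b' ≤ 1 →
      23040 * (4 : ℝ) ^ 4 * (frameC 4 L + 4) ^ 3 * (c' + curConst 4 L * b' ^ 2) ≤ 1 →
      ∀ ⦃α : ℝ⦄, 0 < α → C0 4 * α ≤ 1 / 3 → 2 * α ≤ c2' 4 L → 11 * (4 : ℝ) ^ 2 * α ≤ 1 / 6 → α + 11 * (4 : ℝ) ^ 2 * α ≤ c₁' →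
      b' + 226 * (8 * ((4 : ℝ) + 1) * ((4 : ℝ) + 4)) ^ 2 * b' ^ 2 < α → 4 * ((4 : ℝ) - 1) * (c' + curConst 4 L * b' ^ 2) < α →
      ∀ ⦃Mc : ℝ⦄, 0 ≤ Mc → (Mc + 1) * (b' + 226 * (8 * ((4 : ℝ) + 1) * ((4 : ℝ) + 4)) ^ 2 * b' ^ 2) ≤ 1 / 2 →
      ∀ (𝒬 : ℕ → Set (Set (Site 4) × ℕ)), (∀ k, ∀ q ∈ 𝒬 k, q.2 ≤ k ∧ ∃ y : Site 4, ∀ z ∈ q.1, (l1 (z - y) : ℝ) ≤ Mc * (L : ℝ) ^ q.2) →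
      ∀ ⦃C335 : ℝ⦄, 2 * (Mc + 1) * (b' + 226 * (8 * ((4 : ℝ) + 1) * ((4 : ℝ) + 4)) ^ 2 * b' ^ 2) + 2 * Mc * (2 * (c' + curConst 4 L * b' ^ 2)) +
        4 * Mc * (1 + 2 * Mc) * (b' + 226 * (8 * ((4 : ℝ) + 1) * ((4 : ℝ) + 4)) ^ 2 * b' ^ 2) ^ 2 < C335 →
      ∀ ⦃ε s₁ b s₂ : ℝ⦄, 0 < ε → ε ≤ r → ε < α → 0 ≤ s₁ → s₁ ≤ r → 0 ≤ b → b ≤ ε / 2 →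
      5 * ((4 : ℕ) : ℝ) * L * inp.B₀ * (α + 11 * (4 : ℝ) ^ 2 * α) ≤ s₁ →
      5 * ((4 : ℕ) : ℝ) * L * inp.B₀ * (α + 11 * (4 : ℝ) ^ 2 * α) +
          2 * (b' + 226 * (8 * ((4 : ℝ) + 1) * ((4 : ℝ) + 4)) ^ 2 * b' ^ 2) * s₁ ≤ s₁ →
      5 * ((4 : ℕ) : ℝ) * L * inp.B₀ * (α + 11 * (4 : ℝ) ^ 2 * α) + 16 * (b' + 226 * (8 * ((4 : ℝ) + 1) * ((4 : ℝ) + 4)) ^ 2 * b' ^ 2) *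
          (5 * ((4 : ℕ) : ℝ) * L * inp.B₀ * (α + 11 * (4 : ℝ) ^ 2 * α)) ≤ s₁ →
      5 * ((4 : ℕ) : ℝ) * L * B₀β * (α + 11 * (4 : ℝ) ^ 2 * α) + 10 * (b' + 226 * (8 * ((4 : ℝ) + 1) * ((4 : ℝ) + 4)) ^ 2 * b' ^ 2) *
          (5 * ((4 : ℕ) : ℝ) * L * inp.B₀ * (α + 11 * (4 : ℝ) ^ 2 * α)) ≤ s₂ →
      ∀ ⦃β : ℝ⦄, 0 ≤ β → β ≤ 1 →
      B8.Thm4Body c₁ B₁' (fun i : {i : ZdIdx 4 L // (∀ j, i.Ω j = Set.univ) ∧ (∀ m j, i.Λs m j = {_y | j = m}) ∧ (∀ m j, i.Λb m j = {_c | j = m}) ∧ i.η = ((L : ℝ)⁻¹) ^ i.k} =>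
        (zdGF3 (Matrix n n ℂ) L β len i.1).toGFData) →
      B8.Prop3Body cP 4 (L : ℝ) C₂ inp B₀β (fun i : {i : ZdIdx 4 L // (∀ j, i.Ω j = Set.univ) ∧ (∀ m j, i.Λs m j = {_y | j = m}) ∧ (∀ m j, i.Λb m j = {_c | j = m}) ∧ i.η = ((L : ℝ)⁻¹) ^ i.k} =>
        (zdGF3 (Matrix n n ℂ) L β len i.1).toGFData2) →
      ∀ {dom : _root_.Set (Site 4 → Fin 4 → (Matrix n n ℂ)ˣ)},
        LeafH3sup 4 L N ε b' c' dom →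
        CovRootHolderMS 4 (sfClass 4 L N ε) L N b g C s₁ s₂ β dom := by
  letI : CStarAlgebra (Matrix n n ℂ) := {}
  obtain ⟨r, hr0, hr⟩ := n16_holderMS_of_thm4Zd_printMS (n := n) hL hN
  refine ⟨r, hr0, fun g hg => ?_⟩
  obtain ⟨C, hC0, hC⟩ := hr hg
  refine ⟨C, hC0, fun c₁ c₁' B₁' cP C₂ B₀β inp len hlen hlen1 hB₁' hBB h16 hwin b' c' hb' hc' hRb hcF α hα hA3 hA2 hAs hAc hb'α hc'α Mc hMc
    hMcα 𝒬 h𝒬 C335 hC335 ε s₁ b s₂ hε hεr hεα hs₁ hs₁r hb hbh hss hgrad hℓ hhol β hβ0 hβ1 hT hP dom h3 => ?_⟩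
  have hB0 : 0 ≤ 5 * ((4 : ℕ) : ℝ) * L * inp.B₀ := by have := inp.B₀_pos.le; positivity
  have hT4 := thm4TorusAt_printMS_of_leaf_allTorusPinned (d := 4) (by norm_num) hL hβ0 hlen hlen1 hB₁' hBB hwin
    (fun k => Reg335Zd (((L : ℝ) ^ k)⁻¹) L (𝒬 k) C335) hT hP
  exact hC c₁' (5 * ((4 : ℕ) : ℝ) * L * inp.B₀) (5 * ((4 : ℕ) : ℝ) * L * B₀β) hB0 h16 hb' hc' hRb hcF hα hA3 hA2 hAs hAc hb'α hc'α hMc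
    hMcα 𝒬 h𝒬 hC335 hε hεr hεα hs₁ hs₁r hb hbh hss hgrad hℓ hhol hβ0 hβ1 hT4 h3

/-! ## §3 ★ N16's multi-scale β-root from n05-a's sockets AT THE PINNED ALL-TORUS MEMBERS ONLY (⊂ `IdxB8SubB`), and N07's (H3ˢᵘᵖ) -/

/-- ★ **N16 · THE MULTI-SCALE β-ROOT FROM NODE N05's FIVE SOCKETS ON THE PINNED ALL-TORUS SUB-FAMILY OF `zdGF3 (M_n(ℂ)) L β l1Len` AND N07's (H3ˢᵘᵖ)** (`d = 4`,
`L ≥ 2`, `N ≥ 1`, ANY `β ∈ [0,1]`; print's ℓ¹ length, both length letters discharged): file 46's `n16_holderMS_of_socketsAllTorus_l1Len` with the spacing pinned to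
`η = L^{−k}` — sockets demanded at members of node N05's record sub-index `IdxB8SubB` only (file 47 §1).  Conclusion VERBATIM.  N16 ∕ NE3 NOT proved.
[cite: Balaban1985RegularSpaces, Thm 4 p.88, Prop. 3 p.87, Prop. 5 p.94, (1.59) p.86, (1.36) p.82; Balaban1985BackgroundPropagators, (3.40) p.397] [folklore] -/
theorem n16_holderMS_of_socketsAllTorusPinned_l1Len [Nonempty n] {L N : ℕ} (hL : 2 ≤ L) (hN : 1 ≤ N) :
    letI : CStarAlgebra (Matrix n n ℂ) := {}
    ∃ r : ℝ, 0 < r ∧ ∀ ⦃g : ℝ⦄, 0 < g → ∃ C : ℝ, 0 ≤ C ∧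
      ∀ ⦃β : ℝ⦄, 0 ≤ β → β ≤ 1 → ∀ (C₂ B₀ B₀' cu cP : ℝ) (inp : B8.B9Inputs) (B₀β : ℝ),
      0 < B₀ → inp.B₀ ≤ B₀ → 0 < B₀' → 2 ≤ 5 * ((4 : ℕ) : ℝ) * L * B₀ → 0 < cu → 0 < cP → 0 ≤ B₀β →
      2097152 * (((4 : ℕ) : ℝ) + 1) ^ 2 ≤ C₂ →
      (∀ i : {i : ZdIdx 4 L // (∀ j, i.Ω j = Set.univ) ∧ (∀ m j, i.Λs m j = {_y | j = m}) ∧ (∀ m j, i.Λb m j = {_c | j = m}) ∧ i.η = ((L : ℝ)⁻¹) ^ i.k}, SockP5base (𝔸 := Matrix n n ℂ) L B₀ B₀' cP i.1.η i.1.k i.1.Ω i.1.Λs) →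
      (∀ i : {i : ZdIdx 4 L // (∀ j, i.Ω j = Set.univ) ∧ (∀ m j, i.Λs m j = {_y | j = m}) ∧ (∀ m j, i.Λb m j = {_c | j = m}) ∧ i.η = ((L : ℝ)⁻¹) ^ i.k}, SockP5 (𝔸 := Matrix n n ℂ) L B₀ B₀' cP i.1.η i.1.k i.1.Ω i.1.Λs) →
      (∀ i : {i : ZdIdx 4 L // (∀ j, i.Ω j = Set.univ) ∧ (∀ m j, i.Λs m j = {_y | j = m}) ∧ (∀ m j, i.Λb m j = {_c | j = m}) ∧ i.η = ((L : ℝ)⁻¹) ^ i.k}, SockH59 (𝔸 := Matrix n n ℂ) L B₀ B₀' cP i.1.η i.1.k i.1.Ω i.1.Λs i.1.Λb) →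
      (∀ i : {i : ZdIdx 4 L // (∀ j, i.Ω j = Set.univ) ∧ (∀ m j, i.Λs m j = {_y | j = m}) ∧ (∀ m j, i.Λb m j = {_c | j = m}) ∧ i.η = ((L : ℝ)⁻¹) ^ i.k}, SockP5uE (𝔸 := Matrix n n ℂ) L B₀ cP cu i.1.η i.1.k i.1.Ω i.1.Λs) →
      (∀ i : {i : ZdIdx 4 L // (∀ j, i.Ω j = Set.univ) ∧ (∀ m j, i.Λs m j = {_y | j = m}) ∧ (∀ m j, i.Λb m j = {_c | j = m}) ∧ i.η = ((L : ℝ)⁻¹) ^ i.k}, SockB9P3 (𝔸 := Matrix n n ℂ) L inp.B₀ B₀β cP β l1Len i.1.η i.1.k i.1.Ω i.1.Λs i.1.Λb) →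
      ∃ c₁' : ℝ, 0 < c₁' ∧ 16 * (5 * ((4 : ℕ) : ℝ) * L * inp.B₀ * c₁') ≤ 1 ∧
      ∀ ⦃b' c' : ℝ⦄, 0 ≤ b' → 0 ≤ c' →
      2 ^ 15 * ((4 : ℝ) + 1) ^ 2 * ((4 : ℝ) + 4) ^ 2 * (L : ℝ) ^ 2 * b' ≤ 1 →
      23040 * (4 : ℝ) ^ 4 * (frameC 4 L + 4) ^ 3 * (c' + curConst 4 L * b' ^ 2) ≤ 1 →
      ∀ ⦃α : ℝ⦄, 0 < α → C0 4 * α ≤ 1 / 3 → 2 * α ≤ c2' 4 L → 11 * (4 : ℝ) ^ 2 * α ≤ 1 / 6 → α + 11 * (4 : ℝ) ^ 2 * α ≤ c₁' →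
      b' + 226 * (8 * ((4 : ℝ) + 1) * ((4 : ℝ) + 4)) ^ 2 * b' ^ 2 < α → 4 * ((4 : ℝ) - 1) * (c' + curConst 4 L * b' ^ 2) < α →
      ∀ ⦃Mc : ℝ⦄, 0 ≤ Mc → (Mc + 1) * (b' + 226 * (8 * ((4 : ℝ) + 1) * ((4 : ℝ) + 4)) ^ 2 * b' ^ 2) ≤ 1 / 2 →
      ∀ (𝒬 : ℕ → Set (Set (Site 4) × ℕ)), (∀ k, ∀ q ∈ 𝒬 k, q.2 ≤ k ∧ ∃ y : Site 4, ∀ z ∈ q.1, (l1 (z - y) : ℝ) ≤ Mc * (L : ℝ) ^ q.2) →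
      ∀ ⦃C335 : ℝ⦄, 2 * (Mc + 1) * (b' + 226 * (8 * ((4 : ℝ) + 1) * ((4 : ℝ) + 4)) ^ 2 * b' ^ 2) + 2 * Mc * (2 * (c' + curConst 4 L * b' ^ 2)) +
        4 * Mc * (1 + 2 * Mc) * (b' + 226 * (8 * ((4 : ℝ) + 1) * ((4 : ℝ) + 4)) ^ 2 * b' ^ 2) ^ 2 < C335 →
      ∀ ⦃ε s₁ b s₂ : ℝ⦄, 0 < ε → ε ≤ r → ε < α → 0 ≤ s₁ → s₁ ≤ r → 0 ≤ b → b ≤ ε / 2 →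
      5 * ((4 : ℕ) : ℝ) * L * inp.B₀ * (α + 11 * (4 : ℝ) ^ 2 * α) ≤ s₁ →
      5 * ((4 : ℕ) : ℝ) * L * inp.B₀ * (α + 11 * (4 : ℝ) ^ 2 * α) +
          2 * (b' + 226 * (8 * ((4 : ℝ) + 1) * ((4 : ℝ) + 4)) ^ 2 * b' ^ 2) * s₁ ≤ s₁ →
      5 * ((4 : ℕ) : ℝ) * L * inp.B₀ * (α + 11 * (4 : ℝ) ^ 2 * α) + 16 * (b' + 226 * (8 * ((4 : ℝ) + 1) * ((4 : ℝ) + 4)) ^ 2 * b' ^ 2) *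
          (5 * ((4 : ℕ) : ℝ) * L * inp.B₀ * (α + 11 * (4 : ℝ) ^ 2 * α)) ≤ s₁ →
      5 * ((4 : ℕ) : ℝ) * L * B₀β * (α + 11 * (4 : ℝ) ^ 2 * α) + 10 * (b' + 226 * (8 * ((4 : ℝ) + 1) * ((4 : ℝ) + 4)) ^ 2 * b' ^ 2) *
          (5 * ((4 : ℕ) : ℝ) * L * inp.B₀ * (α + 11 * (4 : ℝ) ^ 2 * α)) ≤ s₂ →
      ∀ {dom : _root_.Set (Site 4 → Fin 4 → (Matrix n n ℂ)ˣ)},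
        LeafH3sup 4 L N ε b' c' dom →
        CovRootHolderMS 4 (sfClass 4 L N ε) L N b g C s₁ s₂ β dom := by
  letI : CStarAlgebra (Matrix n n ℂ) := {}
  obtain ⟨r, hr0, hr⟩ := n16_holderMS_of_leafAllTorusPinned (n := n) hL hN
  refine ⟨r, hr0, fun g hg => ?_⟩
  obtain ⟨C, hC0, hC⟩ := hr hg
  refine ⟨C, hC0, fun β hβ0 hβ1 C₂ B₀ B₀' cu cP inp B₀β hB₀ hiB hB₀' hB hcu hcP hB₀β hC₂ SP5base SP5 SH59 SP5u SB9 => ?_⟩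
  -- node N05's Theorem 4 ∕ Proposition 3 on the PINNED all-torus sub-family from the sockets there (n05-a, `ι := Subtype.val`)
  obtain ⟨c₁t, hc₁t, hT⟩ := B8LeafKnitZd3E.thm4Printed_zd3_mapE (𝔸 := Matrix n n ℂ) (d := 4) (by norm_num) hL (β := β)
    (len := l1Len) hB₀ hB₀' hB hcu hcP (fun i : {i : ZdIdx 4 L // (∀ j, i.Ω j = Set.univ) ∧ (∀ m j, i.Λs m j = {_y | j = m}) ∧ (∀ m j, i.Λb m j = {_c | j = m}) ∧ i.η = ((L : ℝ)⁻¹) ^ i.k} => i.1) SP5base SP5 SH59 SP5u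
  obtain ⟨cP', hcP', hP⟩ := B8LeafModelZd3Map.prop3Printed_zd3_map (𝔸 := Matrix n n ℂ) (d := 4) (by norm_num) hL inp hB₀β hC₂ hcP
    β l1Len (fun i : {i : ZdIdx 4 L // (∀ j, i.Ω j = Set.univ) ∧ (∀ m j, i.Λs m j = {_y | j = m}) ∧ (∀ m j, i.Λb m j = {_c | j = m}) ∧ i.η = ((L : ℝ)⁻¹) ^ i.k} => i.1) SB9
  -- the letter `B₁′ := 5·4·L·B₀` and the window threshold below the two printed thresholds
  have hLpos : (0 : ℝ) < L := by exact_mod_cast (show 0 < L by omega)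
  have hB₁' : 0 < 5 * ((4 : ℕ) : ℝ) * L * B₀ := by positivity
  have hBB : 5 * ((4 : ℕ) : ℝ) * L * inp.B₀ ≤ 5 * ((4 : ℕ) : ℝ) * L * B₀ := mul_le_mul_of_nonneg_left hiB (by positivity)
  obtain ⟨c₁', hc₁', hwin⟩ := exists_window_print (d := 4) (L := L) (by norm_num) hL C₂ hc₁t hcP' hB₁'
  have h16 : 16 * (5 * ((4 : ℕ) : ℝ) * L * inp.B₀ * c₁') ≤ 1 := by
    obtain ⟨-, -, -, h, -⟩ := hwin (c₁' / 2) (c₁' / 2) (by linarith) (by linarith) (by linarith)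
    have h' : 16 * (5 * ((4 : ℕ) : ℝ) * L * B₀ * c₁') ≤ 1 := by rwa [add_halves] at h
    nlinarith [mul_le_mul_of_nonneg_right hBB hc₁'.le]
  refine ⟨c₁', hc₁', h16, fun b' c' hb' hc' hRb hcF α hα hA3 hA2 hAs hAc hb'α hc'α Mc hMc hMcα 𝒬 h𝒬 C335 hC335 ε s₁ b s₂ hε hεr hεα hs₁
    hs₁r hb hbh hss hgrad hℓ hhol dom h3 => ?_⟩
  exact hC c₁t c₁' (5 * ((4 : ℕ) : ℝ) * L * B₀) cP' C₂ B₀β inp l1Len (fun v hv => one_le_l1Len hv) l1Len_nsmul_e hB₁' hBB h16 hwin hb' hc'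
    hRb hcF hα hA3 hA2 hAs hAc hb'α hc'α hMc hMcα 𝒬 h𝒬 hC335 hε hεr hεα hs₁ hs₁r hb hbh hss hgrad hℓ hhol hβ0 hβ1 hT hP h3

/-- ★ **THE SAME IN THE PROVIDERS' PLAIN FIXED-POINT CURRENCY (`SockHFP₀`∕`SockHFP`, FOUR THRESHOLDS) AT THE PINNED ALL-TORUS MEMBERS**: file 46's
`n16_holderMS_of_socketsHFP₄AllTorus_l1Len` with the spacing pinned to `η = L^{−k}`; conclusion VERBATIM.  N16 ∕ NE3 NOT proved.
[cite: Balaban1985RegularSpaces, Thm 4 p.88, Prop. 3 p.87, Prop. 5 (1.106)–(1.109) p.94, (1.59) p.86; Balaban1985BackgroundPropagators, (3.40) p.397] [folklore] -/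
theorem n16_holderMS_of_socketsHFP₄AllTorusPinned_l1Len [Nonempty n] {L N : ℕ} (hL : 2 ≤ L) (hN : 1 ≤ N) :
    letI : CStarAlgebra (Matrix n n ℂ) := {}
    ∃ r : ℝ, 0 < r ∧ ∀ ⦃g : ℝ⦄, 0 < g → ∃ C : ℝ, 0 ≤ C ∧
      ∀ ⦃β : ℝ⦄, 0 ≤ β → β ≤ 1 → ∀ (C₂ B₀ B₀' cu cF₀ cF c59 cu' cP : ℝ) (inp : B8.B9Inputs) (B₀β : ℝ),
      0 < B₀ → inp.B₀ ≤ B₀ → 0 < B₀' → 2 ≤ 5 * ((4 : ℕ) : ℝ) * L * B₀ → 0 < cu → 0 < cF₀ → 0 < cF → 0 < c59 → 0 < cu' → 0 < cP →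
      0 ≤ B₀β → 2097152 * (((4 : ℕ) : ℝ) + 1) ^ 2 ≤ C₂ →
      (∀ i : {i : ZdIdx 4 L // (∀ j, i.Ω j = Set.univ) ∧ (∀ m j, i.Λs m j = {_y | j = m}) ∧ (∀ m j, i.Λb m j = {_c | j = m}) ∧ i.η = ((L : ℝ)⁻¹) ^ i.k}, SockHFP₀ (𝔸 := Matrix n n ℂ) L B₀ B₀' cF₀ i.1.η i.1.k i.1.Ω i.1.Λs) →
      (∀ i : {i : ZdIdx 4 L // (∀ j, i.Ω j = Set.univ) ∧ (∀ m j, i.Λs m j = {_y | j = m}) ∧ (∀ m j, i.Λb m j = {_c | j = m}) ∧ i.η = ((L : ℝ)⁻¹) ^ i.k}, SockHFP (𝔸 := Matrix n n ℂ) L B₀ B₀' cF i.1.η i.1.k i.1.Ω i.1.Λs) →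
      (∀ i : {i : ZdIdx 4 L // (∀ j, i.Ω j = Set.univ) ∧ (∀ m j, i.Λs m j = {_y | j = m}) ∧ (∀ m j, i.Λb m j = {_c | j = m}) ∧ i.η = ((L : ℝ)⁻¹) ^ i.k}, SockH59 (𝔸 := Matrix n n ℂ) L B₀ B₀' c59 i.1.η i.1.k i.1.Ω i.1.Λs i.1.Λb) →
      (∀ i : {i : ZdIdx 4 L // (∀ j, i.Ω j = Set.univ) ∧ (∀ m j, i.Λs m j = {_y | j = m}) ∧ (∀ m j, i.Λb m j = {_c | j = m}) ∧ i.η = ((L : ℝ)⁻¹) ^ i.k}, SockP5uE (𝔸 := Matrix n n ℂ) L B₀ cu' cu i.1.η i.1.k i.1.Ω i.1.Λs) →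
      (∀ i : {i : ZdIdx 4 L // (∀ j, i.Ω j = Set.univ) ∧ (∀ m j, i.Λs m j = {_y | j = m}) ∧ (∀ m j, i.Λb m j = {_c | j = m}) ∧ i.η = ((L : ℝ)⁻¹) ^ i.k}, SockB9P3 (𝔸 := Matrix n n ℂ) L inp.B₀ B₀β cP β l1Len i.1.η i.1.k i.1.Ω i.1.Λs i.1.Λb) →
      ∃ c₁' : ℝ, 0 < c₁' ∧ 16 * (5 * ((4 : ℕ) : ℝ) * L * inp.B₀ * c₁') ≤ 1 ∧
      ∀ ⦃b' c' : ℝ⦄, 0 ≤ b' → 0 ≤ c' →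
      2 ^ 15 * ((4 : ℝ) + 1) ^ 2 * ((4 : ℝ) + 4) ^ 2 * (L : ℝ) ^ 2 * b' ≤ 1 →
      23040 * (4 : ℝ) ^ 4 * (frameC 4 L + 4) ^ 3 * (c' + curConst 4 L * b' ^ 2) ≤ 1 →
      ∀ ⦃α : ℝ⦄, 0 < α → C0 4 * α ≤ 1 / 3 → 2 * α ≤ c2' 4 L → 11 * (4 : ℝ) ^ 2 * α ≤ 1 / 6 → α + 11 * (4 : ℝ) ^ 2 * α ≤ c₁' →
      b' + 226 * (8 * ((4 : ℝ) + 1) * ((4 : ℝ) + 4)) ^ 2 * b' ^ 2 < α → 4 * ((4 : ℝ) - 1) * (c' + curConst 4 L * b' ^ 2) < α →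
      ∀ ⦃Mc : ℝ⦄, 0 ≤ Mc → (Mc + 1) * (b' + 226 * (8 * ((4 : ℝ) + 1) * ((4 : ℝ) + 4)) ^ 2 * b' ^ 2) ≤ 1 / 2 →
      ∀ (𝒬 : ℕ → Set (Set (Site 4) × ℕ)), (∀ k, ∀ q ∈ 𝒬 k, q.2 ≤ k ∧ ∃ y : Site 4, ∀ z ∈ q.1, (l1 (z - y) : ℝ) ≤ Mc * (L : ℝ) ^ q.2) →
      ∀ ⦃C335 : ℝ⦄, 2 * (Mc + 1) * (b' + 226 * (8 * ((4 : ℝ) + 1) * ((4 : ℝ) + 4)) ^ 2 * b' ^ 2) + 2 * Mc * (2 * (c' + curConst 4 L * b' ^ 2)) +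
        4 * Mc * (1 + 2 * Mc) * (b' + 226 * (8 * ((4 : ℝ) + 1) * ((4 : ℝ) + 4)) ^ 2 * b' ^ 2) ^ 2 < C335 →
      ∀ ⦃ε s₁ b s₂ : ℝ⦄, 0 < ε → ε ≤ r → ε < α → 0 ≤ s₁ → s₁ ≤ r → 0 ≤ b → b ≤ ε / 2 →
      5 * ((4 : ℕ) : ℝ) * L * inp.B₀ * (α + 11 * (4 : ℝ) ^ 2 * α) ≤ s₁ →
      5 * ((4 : ℕ) : ℝ) * L * inp.B₀ * (α + 11 * (4 : ℝ) ^ 2 * α) +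
          2 * (b' + 226 * (8 * ((4 : ℝ) + 1) * ((4 : ℝ) + 4)) ^ 2 * b' ^ 2) * s₁ ≤ s₁ →
      5 * ((4 : ℕ) : ℝ) * L * inp.B₀ * (α + 11 * (4 : ℝ) ^ 2 * α) + 16 * (b' + 226 * (8 * ((4 : ℝ) + 1) * ((4 : ℝ) + 4)) ^ 2 * b' ^ 2) *
          (5 * ((4 : ℕ) : ℝ) * L * inp.B₀ * (α + 11 * (4 : ℝ) ^ 2 * α)) ≤ s₁ →
      5 * ((4 : ℕ) : ℝ) * L * B₀β * (α + 11 * (4 : ℝ) ^ 2 * α) + 10 * (b' + 226 * (8 * ((4 : ℝ) + 1) * ((4 : ℝ) + 4)) ^ 2 * b' ^ 2) *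
          (5 * ((4 : ℕ) : ℝ) * L * inp.B₀ * (α + 11 * (4 : ℝ) ^ 2 * α)) ≤ s₂ →
      ∀ {dom : _root_.Set (Site 4 → Fin 4 → (Matrix n n ℂ)ˣ)},
        LeafH3sup 4 L N ε b' c' dom →
        CovRootHolderMS 4 (sfClass 4 L N ε) L N b g C s₁ s₂ β dom := by
  letI : CStarAlgebra (Matrix n n ℂ) := {}
  obtain ⟨r, hr0, hr⟩ := n16_holderMS_of_leafAllTorusPinned (n := n) hL hN
  refine ⟨r, hr0, fun g hg => ?_⟩
  obtain ⟨C, hC0, hC⟩ := hr hg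
  refine ⟨C, hC0, fun β hβ0 hβ1 C₂ B₀ B₀' cu cF₀ cF c59 cu' cP inp B₀β hB₀ hiB hB₀' hB hcu hcF₀ hcF hc59 hcu' hcP hB₀β hC₂ SHFP₀ SHFP SH59
    SP5u SB9 => ?_⟩
  -- node N05's Theorem 4 ∕ Proposition 3 on the PINNED all-torus sub-family from the sockets there (n05-a, `ι := Subtype.val`)
  obtain ⟨c₁t, hc₁t, hT⟩ := B8LeafKnitZd3E.thm4Printed_zd3_of_HFP₄_mapE (𝔸 := Matrix n n ℂ) (d := 4) (by norm_num) hL (β := β)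
    (len := l1Len) hB₀ hB₀' hB hcu hcF₀ hcF hc59 hcu' (fun i : {i : ZdIdx 4 L // (∀ j, i.Ω j = Set.univ) ∧ (∀ m j, i.Λs m j = {_y | j = m}) ∧ (∀ m j, i.Λb m j = {_c | j = m}) ∧ i.η = ((L : ℝ)⁻¹) ^ i.k} => i.1) SHFP₀ SHFP SH59 SP5u
  obtain ⟨cP', hcP', hP⟩ := B8LeafModelZd3Map.prop3Printed_zd3_map (𝔸 := Matrix n n ℂ) (d := 4) (by norm_num) hL inp hB₀β hC₂ hcP
    β l1Len (fun i : {i : ZdIdx 4 L // (∀ j, i.Ω j = Set.univ) ∧ (∀ m j, i.Λs m j = {_y | j = m}) ∧ (∀ m j, i.Λb m j = {_c | j = m}) ∧ i.η = ((L : ℝ)⁻¹) ^ i.k} => i.1) SB9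
  -- the letter `B₁′ := 5·4·L·B₀` and the window threshold below the two printed thresholds
  have hLpos : (0 : ℝ) < L := by exact_mod_cast (show 0 < L by omega)
  have hB₁' : 0 < 5 * ((4 : ℕ) : ℝ) * L * B₀ := by positivity
  have hBB : 5 * ((4 : ℕ) : ℝ) * L * inp.B₀ ≤ 5 * ((4 : ℕ) : ℝ) * L * B₀ := mul_le_mul_of_nonneg_left hiB (by positivity)
  obtain ⟨c₁', hc₁', hwin⟩ := exists_window_print (d := 4) (L := L) (by norm_num) hL C₂ hc₁t hcP' hB₁'
  have h16 : 16 * (5 * ((4 : ℕ) : ℝ) * L * inp.B₀ * c₁') ≤ 1 := by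
    obtain ⟨-, -, -, h, -⟩ := hwin (c₁' / 2) (c₁' / 2) (by linarith) (by linarith) (by linarith)
    have h' : 16 * (5 * ((4 : ℕ) : ℝ) * L * B₀ * c₁') ≤ 1 := by rwa [add_halves] at h
    nlinarith [mul_le_mul_of_nonneg_right hBB hc₁'.le]
  refine ⟨c₁', hc₁', h16, fun b' c' hb' hc' hRb hcF α hα hA3 hA2 hAs hAc hb'α hc'α Mc hMc hMcα 𝒬 h𝒬 C335 hC335 ε s₁ b s₂ hε hεr hεα hs₁
    hs₁r hb hbh hss hgrad hℓ hhol dom h3 => ?_⟩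
  exact hC c₁t c₁' (5 * ((4 : ℕ) : ℝ) * L * B₀) cP' C₂ B₀β inp l1Len (fun v hv => one_le_l1Len hv) l1Len_nsmul_e hB₁' hBB h16 hwin hb' hc'
    hRb hcF hα hA3 hA2 hAs hAc hb'α hc'α hMc hMcα 𝒬 h𝒬 hC335 hε hεr hεα hs₁ hs₁r hb hbh hss hgrad hℓ hhol hβ0 hβ1 hT hP h3

end Matrices

end

end Summit.QuantumFields.YangMills.BalabanUVNodes.N16HolderMSOfSocketsAllTorusPinned
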